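import Summits.CriticalPhenomena.PercolationContinuityZ3.Theorems.PercNearOneGluingNoHeavyLowerTailGuardedSomeTerminalSeparation
import Summits.CriticalPhenomena.PercolationContinuityZ3.Theorems.PercNearOneGluingNoHeavyLowerTailGuardedLonelyRelay
import HarnessLib

/-!
# `NoHeavyLowerTail` (stmt-CriticalPhenomena-4575) — champion stability for vertex pairs at LEVEL ONE: events and rows

Seat `prim-gen-swap`, 2026-08-18.  `μ = prodBernoulli w` on `Fin n`, relays `A`, two vertices `x, y`, and a relay `c ∈ A`
that is a CHAMPION at level `1`: `μ(b isolated) ≤ μ(c isolated)` for every `b ∈ A` ("isolated" = joined to no other relay,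
i.e. `|π(b)| ≤ 1`).  Then (`championStabilityPair_level_one`)

  `μ(c ↮ x, c ↮ y, |π(x) ∪ π(y)| = 1) ≤ μ(c ↮ x, c ↮ y, c isolated)`,

the `j = 1` instance of the registered stub `stub_championStabilityPair` (which, for all `j`, closes the crux:
`Theorems.noHeavyLowerTail_of_championStabilityPair`).  Proof (report MERGE-STABILITY.md): with `O = {x,y}`,
`D_b = {b ↮ A∖b}`, `M = {A pairwise separated}`, `E_b = {b ↔ O-some} ∩ D_b ∩ {A∖b ↮ O}` (the event "the relays seen
from `O` are exactly `{b}`"):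
(1) `μ(E_b) μ(M) ≤ μ(D_b) μ(E_b ∩ M)` — `terminalSeparation_some_guarded` with guard `{A∖b ↮ O}`;
(2) `μ(D_b) ≤ μ(D_c) + η` (champion, with slack `η`);
(3) the `E_b ∩ M`, `b ≠ c`, are disjoint sub-events of `M ∩ {c ↮ O}`;
(4) `μ({c ↔ O-some} ∩ D_c) μ(M) ≤ μ(D_c) μ({c ↔ O-some} ∩ M)` (the same row without guard), whence
    `μ(D_c) μ(M ∩ {c ↮ O}) ≤ μ(M) μ(D_c ∩ {c ↮ O})`;
so `μ(E) μ(M) ≤ μ(M) (μ(D_c ∩ {c ↮ O}) + η)`; divide by `μ(M) > 0` when all weights are `< 1`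
(`championStabilityPair_level_one_of_lt`), and pass to the limit `w_k = (1 - 1/(k+1)) w → w` with
`stub_weightContinuity` (the champion hypothesis at `w` gives slack `η_k → 0` at `w_k`).
-/

noncomputable section

namespace Summit.CriticalPhenomena.PercolationContinuityZ3.Theorems

open scoped BigOperators Classical Topology
open MeasureTheory Set Filter
open Literature.Probability.LatticeModels (prodBernoulli)
open Literature.Probability.Percolation

variable {n : ℕ}

namespace CSLevelOne

/-! ### Events -/

omit n in
/-- `openConn` is symmetric. [folklore] -/
theorem openConn_comm' {m : ℕ} (ω : BondConfig (Fin m)) (u v : Fin m) :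
    ω ∈ openConn u v ↔ ω ∈ openConn v u :=
  ⟨fun h => SimpleGraph.Reachable.symm h, fun h => SimpleGraph.Reachable.symm h⟩

/-- `D_b ∩ Qsep_b = M` for `b ∈ A`. [folklore] -/
theorem Dsep_inter_Qsep (A : Finset (Fin n)) {b : Fin n} (hb : b ∈ A) :
    ({ω : BondConfig (Fin n) | ∀ t ∈ A.erase b, ω ∉ openConn b t}) ∩ ({ω : BondConfig (Fin n) | ∀ p ∈ (A.erase b).offDiag, ω ∉ openConn p.1 p.2}) = ({ω : BondConfig (Fin n) | ∀ a ∈ A, ∀ a' ∈ A, a ≠ a' → ω ∉ openConn a a'}) := by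
  ext ω
  simp only [mem_inter_iff, mem_setOf_eq, Finset.mem_offDiag, Finset.mem_erase]
  constructor
  · rintro ⟨hD, hQ⟩ a ha a' ha' hne
    by_cases hab : a = b
    · subst hab
      exact hD a' ⟨fun h => hne h.symm, ha'⟩
    · by_cases hab' : a' = b
      · subst hab'
        rw [openConn_comm']
        exact hD a ⟨hab, ha⟩
      · exact hQ (a, a') ⟨⟨hab, ha⟩, ⟨hab', ha'⟩, hne⟩
  · intro hM
    refine ⟨fun t ht => hM b hb t ht.2 (fun h => ht.1 h.symm), fun p hp => hM p.1 hp.1.2 p.2 hp.2.1.2 hp.2.2⟩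

/-- The complement of `E^∃_c` is `N`. [folklore] -/
theorem not_mem_Esome_iff (x y c : Fin n) (ω : BondConfig (Fin n)) :
    ω ∉ ({ω : BondConfig (Fin n) | ∃ v ∈ ({x, y} : Finset (Fin n)), ω ∈ openConn c v}) ↔ ω ∈ ({ω : BondConfig (Fin n) | ω ∉ openConn c x ∧ ω ∉ openConn c y}) := by
  simp only [mem_setOf_eq, Finset.mem_insert, Finset.mem_singleton, not_exists, not_and]
  constructor
  · intro h
    exact ⟨h x (Or.inl rfl), h y (Or.inr rfl)⟩
  · rintro ⟨hx, hy⟩ v hv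
    rcases hv with rfl | rfl
    · exact hx
    · exact hy

/-- The level-1 small-block event of a relay is its isolation event `D_b`. [folklore] -/
theorem card_le_one_eq_Dsep (A : Finset (Fin n)) {b : Fin n} (hb : b ∈ A) :
    {ω : BondConfig (Fin n) | (A.filter fun z => ω ∈ openConn b z).card ≤ 1} = ({ω : BondConfig (Fin n) | ∀ t ∈ A.erase b, ω ∉ openConn b t}) := by
  ext ω
  simp only [mem_setOf_eq, Finset.mem_erase]
  have hbmem : b ∈ A.filter fun z => ω ∈ openConn b z :=
    Finset.mem_filter.2 ⟨hb, (SimpleGraph.Reachable.refl b : (openGraph ω).Reachable b b)⟩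
  constructor
  · intro hcard t ht hbt
    have htmem : t ∈ A.filter fun z => ω ∈ openConn b z := Finset.mem_filter.2 ⟨ht.2, hbt⟩
    have : (A.filter fun z => ω ∈ openConn b z).card ≤ 1 := hcard
    rw [Finset.card_le_one] at this
    exact ht.1 (this t htmem b hbmem)
  · intro hD
    rw [Finset.card_le_one]
    intro t ht u hu
    have ht' := Finset.mem_filter.1 ht
    have hu' := Finset.mem_filter.1 hu
    have htb : t = b := by
      by_contra hne
      exact hD t ⟨hne, ht'.1⟩ ht'.2
    have hub : u = b := by
      by_contra hne
      exact hD u ⟨hne, hu'.1⟩ hu'.2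
    rw [htb, hub]

/-! ### The covering of the left event by the `E_b` -/

/-- The left event of CS₂ at level 1 is covered by `⋃_{b ∈ A∖c} E_b`. [folklore] -/
theorem lhs_subset_biUnion (A : Finset (Fin n)) (x y c : Fin n) :
    {ω : BondConfig (Fin n) | ω ∉ openConn c x ∧ ω ∉ openConn c y ∧
        1 ≤ (A.filter fun z => ω ∈ openConn x z ∨ ω ∈ openConn y z).card ∧
        (A.filter fun z => ω ∈ openConn x z ∨ ω ∈ openConn y z).card ≤ 1} ⊆
      ⋃ b ∈ A.erase c, (({ω : BondConfig (Fin n) | ∃ v ∈ ({x, y} : Finset (Fin n)), ω ∈ openConn b v}) ∩ (({ω : BondConfig (Fin n) | ∀ t ∈ A.erase b, ω ∉ openConn b t}) ∩ ({ω : BondConfig (Fin n) | ∀ p ∈ (A.erase b) ×ˢ ({x, y} : Finset (Fin n)), ω ∉ openConn p.1 p.2}))) := by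
  intro ω hω
  obtain ⟨hcx, hcy, h1, h2⟩ := hω
  set Fset := A.filter fun z => ω ∈ openConn x z ∨ ω ∈ openConn y z with hF
  have hcard : Fset.card = 1 := le_antisymm h2 h1
  obtain ⟨b, hFb⟩ := Finset.card_eq_one.1 hcard
  have hbF : b ∈ Fset := by rw [hFb]; exact Finset.mem_singleton_self b
  obtain ⟨hbA, hbconn⟩ := Finset.mem_filter.1 hbF
  have huniq : ∀ t ∈ A, (ω ∈ openConn x t ∨ ω ∈ openConn y t) → t = b := by
    intro t ht hconn
    have : t ∈ Fset := Finset.mem_filter.2 ⟨ht, hconn⟩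
    rw [hFb] at this
    exact Finset.mem_singleton.1 this
  have hbc : b ≠ c := by
    rintro rfl
    rcases hbconn with h | h
    · exact hcx ((openConn_comm' ω b x).2 h)
    · exact hcy ((openConn_comm' ω b y).2 h)
  refine mem_iUnion₂.2 ⟨b, Finset.mem_erase.2 ⟨hbc, hbA⟩, ?_, ?_, ?_⟩
  · -- `b ↔ O-some`
    rcases hbconn with h | h
    · exact ⟨x, by simp, (openConn_comm' ω b x).2 h⟩
    · exact ⟨y, by simp, (openConn_comm' ω b y).2 h⟩
  · -- `b ↮ A∖b`
    intro t ht hbt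
    have hbt' : (openGraph ω).Reachable b t := hbt
    have : ω ∈ openConn x t ∨ ω ∈ openConn y t := by
      rcases hbconn with h | h
      · exact Or.inl ((h : (openGraph ω).Reachable x b).trans hbt')
      · exact Or.inr ((h : (openGraph ω).Reachable y b).trans hbt')
    exact (Finset.mem_erase.1 ht).1 (huniq t (Finset.mem_erase.1 ht).2 this)
  · -- the guard `A∖b ↮ O`
    intro p hp hconn
    obtain ⟨hp1, hp2⟩ := Finset.mem_product.1 hp
    have hconn' : ω ∈ openConn p.2 p.1 := (openConn_comm' ω p.1 p.2).1 hconn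
    have : ω ∈ openConn x p.1 ∨ ω ∈ openConn y p.1 := by
      simp only [Finset.mem_insert, Finset.mem_singleton] at hp2
      rcases hp2 with h | h
      · left; rw [h] at hconn'; exact hconn'
      · right; rw [h] at hconn'; exact hconn'
    exact (Finset.mem_erase.1 hp1).1 (huniq p.1 (Finset.mem_erase.1 hp1).2 this)

/-- The events `E_b ∩ M`, `b ∈ A∖c`, are pairwise disjoint. [folklore] -/
theorem pairwiseDisjoint_Eb (A : Finset (Fin n)) (x y c : Fin n) :
    (↑(A.erase c) : Set (Fin n)).PairwiseDisjoint fun b =>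
      ({ω : BondConfig (Fin n) | ∃ v ∈ ({x, y} : Finset (Fin n)), ω ∈ openConn b v}) ∩ (({ω : BondConfig (Fin n) | ∀ t ∈ A.erase b, ω ∉ openConn b t}) ∩ (({ω : BondConfig (Fin n) | ∀ p ∈ (A.erase b) ×ˢ ({x, y} : Finset (Fin n)), ω ∉ openConn p.1 p.2}) ∩ ({ω : BondConfig (Fin n) | ∀ p ∈ (A.erase b).offDiag, ω ∉ openConn p.1 p.2}))) := by
  intro b hb b' hb' hne
  rw [Function.onFun, Set.disjoint_left]
  rintro ω ⟨⟨v, hv, hbv⟩, -, hQb, -⟩ ⟨⟨v', hv', hb'v'⟩, -, -, -⟩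
  -- `b'` is a relay other than `b` joined to `O`: contradicts the guard of `b`
  have hb'A : b' ∈ A.erase b :=
    Finset.mem_erase.2 ⟨hne.symm, (Finset.mem_erase.1 (Finset.mem_coe.1 hb')).2⟩
  exact hQb (b', v') (Finset.mem_product.2 ⟨hb'A, hv'⟩) hb'v'

/-- Each `E_b ∩ M` (`b ≠ c`) lies in `M ∩ N`. [folklore] -/
theorem Eb_inter_subset (A : Finset (Fin n)) (x y : Fin n) {b c : Fin n} (hb : b ∈ A.erase c)
    (hc : c ∈ A) :
    ({ω : BondConfig (Fin n) | ∃ v ∈ ({x, y} : Finset (Fin n)), ω ∈ openConn b v}) ∩ (({ω : BondConfig (Fin n) | ∀ t ∈ A.erase b, ω ∉ openConn b t}) ∩ (({ω : BondConfig (Fin n) | ∀ p ∈ (A.erase b) ×ˢ ({x, y} : Finset (Fin n)), ω ∉ openConn p.1 p.2}) ∩ ({ω : BondConfig (Fin n) | ∀ p ∈ (A.erase b).offDiag, ω ∉ openConn p.1 p.2}))) ⊆ ({ω : BondConfig (Fin n) | ∀ a ∈ A, ∀ a' ∈ A, a ≠ a' → ω ∉ openConn a a'}) ∩ ({ω : BondConfig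 (Fin n) | ω ∉ openConn c x ∧ ω ∉ openConn c y}) := by
  rintro ω ⟨-, hD, hQ, hS⟩
  have hbA : b ∈ A := (Finset.mem_erase.1 hb).2
  refine ⟨?_, ?_, ?_⟩
  · have : ω ∈ ({ω : BondConfig (Fin n) | ∀ t ∈ A.erase b, ω ∉ openConn b t}) ∩ ({ω : BondConfig (Fin n) | ∀ p ∈ (A.erase b).offDiag, ω ∉ openConn p.1 p.2}) := ⟨hD, hS⟩
    rwa [Dsep_inter_Qsep A hbA] at this
  · have hcA : c ∈ A.erase b := Finset.mem_erase.2 ⟨fun h => (Finset.mem_erase.1 hb).1 h.symm, hc⟩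
    exact hQ (c, x) (Finset.mem_product.2 ⟨hcA, by simp⟩)
  · have hcA : c ∈ A.erase b := Finset.mem_erase.2 ⟨fun h => (Finset.mem_erase.1 hb).1 h.symm, hc⟩
    exact hQ (c, y) (Finset.mem_product.2 ⟨hcA, by simp⟩)

/-! ### The two rows -/

/-- Row (1): `μ(E_b) μ(M) ≤ μ(D_b) μ(E_b ∩ M)` (guarded O-some terminal separation). -/
theorem row_b (w : Sym2 (Fin n) → unitInterval) (A : Finset (Fin n)) (x y : Fin n) {b : Fin n}
    (hb : b ∈ A) :
    (prodBernoulli w).real ((({ω : BondConfig (Fin n) | ∃ v ∈ ({x, y} : Finset (Fin n)), ω ∈ openConn b v}) ∩ (({ω : BondConfig (Fin n) | ∀ t ∈ A.erase b, ω ∉ openConn b t}) ∩ ({ω : BondConfig (Fin n) | ∀ p ∈ (A.erase b) ×ˢ ({x, y} : Finset (Fin n)), ω ∉ openConn p.1 p.2})))) * (prodBernoulli w).real (({ω : BondConfig (Fin n) | ∀ a ∈ A, ∀ a' ∈ A, a ≠ a' → ω ∉ openConn a a'})) ≤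
      (prodBernoulli w).real (({ω : BondConfig (Fin n) | ∀ t ∈ A.erase b, ω ∉ openConn b t})) *
        (prodBernoulli w).real (({ω : BondConfig (Fin n) | ∃ v ∈ ({x, y} : Finset (Fin n)), ω ∈ openConn b v}) ∩ (({ω : BondConfig (Fin n) | ∀ t ∈ A.erase b, ω ∉ openConn b t}) ∩ (({ω : BondConfig (Fin n) | ∀ p ∈ (A.erase b) ×ˢ ({x, y} : Finset (Fin n)), ω ∉ openConn p.1 p.2}) ∩ ({ω : BondConfig (Fin n) | ∀ p ∈ (A.erase b).offDiag, ω ∉ openConn p.1 p.2})))) := by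
  have h := terminalSeparation_some_guarded w (A.erase b) ({x, y} : Finset (Fin n)) b
    ((A.erase b) ×ˢ ({x, y} : Finset (Fin n))) ((A.erase b).offDiag)
    (fun p hp => (Finset.mem_product.1 hp).1) (fun p hp => (Finset.mem_offDiag.1 hp).1)
  rw [← Dsep_inter_Qsep A hb]
  exact h

/-- Row (4): `μ(D_c) μ(M ∩ N) ≤ μ(M) μ(D_c ∩ N)`. -/
theorem row_c (w : Sym2 (Fin n) → unitInterval) (A : Finset (Fin n)) (x y : Fin n) {c : Fin n}
    (hc : c ∈ A) :
    (prodBernoulli w).real (({ω : BondConfig (Fin n) | ∀ t ∈ A.erase c, ω ∉ openConn c t})) * (prodBernoulli w).real (({ω : BondConfig (Fin n) | ∀ a ∈ A, ∀ a' ∈ A, a ≠ a' → ω ∉ openConn a a'}) ∩ ({ω : BondConfig (Fin n) | ω ∉ openConn c x ∧ ω ∉ openConn c y})) ≤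
      (prodBernoulli w).real (({ω : BondConfig (Fin n) | ∀ a ∈ A, ∀ a' ∈ A, a ≠ a' → ω ∉ openConn a a'})) * (prodBernoulli w).real (({ω : BondConfig (Fin n) | ∀ t ∈ A.erase c, ω ∉ openConn c t}) ∩ ({ω : BondConfig (Fin n) | ω ∉ openConn c x ∧ ω ∉ openConn c y})) := by
  set μ := prodBernoulli w with hμ
  have h := terminalSeparation_some_guarded w (A.erase c) ({x, y} : Finset (Fin n)) c
    (∅ : Finset (Fin n × Fin n)) ((A.erase c).offDiag)
    (fun p hp => absurd hp (Finset.notMem_empty p)) (fun p hp => (Finset.mem_offDiag.1 hp).1)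
  have hQ0 : {ω : BondConfig (Fin n) | ∀ p ∈ (∅ : Finset (Fin n × Fin n)), ω ∉ openConn p.1 p.2} = univ :=
    Set.eq_univ_of_forall fun ω p hp => absurd hp (Finset.notMem_empty p)
  rw [hQ0, inter_univ, univ_inter] at h
  change μ.real (({ω : BondConfig (Fin n) | ∃ v ∈ ({x, y} : Finset (Fin n)), ω ∈ openConn c v}) ∩ ({ω : BondConfig (Fin n) | ∀ t ∈ A.erase c, ω ∉ openConn c t})) * μ.real (({ω : BondConfig (Fin n) | ∀ t ∈ A.erase c, ω ∉ openConn c t}) ∩ ({ω : BondConfig (Fin n) | ∀ p ∈ (A.erase c).offDiag, ω ∉ openConn p.1 p.2})) ≤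
    μ.real (({ω : BondConfig (Fin n) | ∀ t ∈ A.erase c, ω ∉ openConn c t})) * μ.real (({ω : BondConfig (Fin n) | ∃ v ∈ ({x, y} : Finset (Fin n)), ω ∈ openConn c v}) ∩ (({ω : BondConfig (Fin n) | ∀ t ∈ A.erase c, ω ∉ openConn c t}) ∩ ({ω : BondConfig (Fin n) | ∀ p ∈ (A.erase c).offDiag, ω ∉ openConn p.1 p.2}))) at h
  rw [Dsep_inter_Qsep A hc] at h
  -- complements inside `D_c` and inside `M`
  have hsplitD : μ.real (({ω : BondConfig (Fin n) | ∀ t ∈ A.erase c, ω ∉ openConn c t}) ∩ ({ω : BondConfig (Fin n) | ω ∉ openConn c x ∧ ω ∉ openConn c y})) = μ.real (({ω : BondConfig (Fin n) | ∀ t ∈ A.erase c, ω ∉ openConn c t})) - μ.real (({ω : BondConfig (Fin n) | ∃ v ∈ ({x, y} : Finset (Fin n)), ω ∈ openConn c v}) ∩ ({ω : BondConfig (Fin n) | ∀ t ∈ A.erase c, ω ∉ openConn c t})) := by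
    have := measureReal_inter_add_sdiff (μ := μ) (s := ({ω : BondConfig (Fin n) | ∀ t ∈ A.erase c, ω ∉ openConn c t})) (Set.toFinite (({ω : BondConfig (Fin n) | ∃ v ∈ ({x, y} : Finset (Fin n)), ω ∈ openConn c v}))).measurableSet
    have heq : ({ω : BondConfig (Fin n) | ∀ t ∈ A.erase c, ω ∉ openConn c t}) \ ({ω : BondConfig (Fin n) | ∃ v ∈ ({x, y} : Finset (Fin n)), ω ∈ openConn c v}) = ({ω : BondConfig (Fin n) | ∀ t ∈ A.erase c, ω ∉ openConn c t}) ∩ ({ω : BondConfig (Fin n) | ω ∉ openConn c x ∧ ω ∉ openConn c y}) := by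
      ext ω; rw [Set.mem_sdiff, Set.mem_inter_iff, not_mem_Esome_iff]
    rw [heq, inter_comm] at this
    linarith
  have hsplitM : μ.real (({ω : BondConfig (Fin n) | ∀ a ∈ A, ∀ a' ∈ A, a ≠ a' → ω ∉ openConn a a'}) ∩ ({ω : BondConfig (Fin n) | ω ∉ openConn c x ∧ ω ∉ openConn c y})) = μ.real (({ω : BondConfig (Fin n) | ∀ a ∈ A, ∀ a' ∈ A, a ≠ a' → ω ∉ openConn a a'})) - μ.real (({ω : BondConfig (Fin n) | ∃ v ∈ ({x, y} : Finset (Fin n)), ω ∈ openConn c v}) ∩ ({ω : BondConfig (Fin n) | ∀ a ∈ A, ∀ a' ∈ A, a ≠ a' → ω ∉ openConn a a'})) := by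
    have := measureReal_inter_add_sdiff (μ := μ) (s := ({ω : BondConfig (Fin n) | ∀ a ∈ A, ∀ a' ∈ A, a ≠ a' → ω ∉ openConn a a'})) (Set.toFinite (({ω : BondConfig (Fin n) | ∃ v ∈ ({x, y} : Finset (Fin n)), ω ∈ openConn c v}))).measurableSet
    have heq : ({ω : BondConfig (Fin n) | ∀ a ∈ A, ∀ a' ∈ A, a ≠ a' → ω ∉ openConn a a'}) \ ({ω : BondConfig (Fin n) | ∃ v ∈ ({x, y} : Finset (Fin n)), ω ∈ openConn c v}) = ({ω : BondConfig (Fin n) | ∀ a ∈ A, ∀ a' ∈ A, a ≠ a' → ω ∉ openConn a a'}) ∩ ({ω : BondConfig (Fin n) | ω ∉ openConn c x ∧ ω ∉ openConn c y}) := by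
      ext ω; rw [Set.mem_sdiff, Set.mem_inter_iff, not_mem_Esome_iff]
    rw [heq, inter_comm] at this
    linarith
  rw [hsplitD, hsplitM]
  nlinarith [h]

/-! ### The bound when all weights are `< 1` (then `μ(M) > 0`) -/

/-- **Level-1 champion stability with slack, all weights `< 1`.** -/
theorem le_of_lt (w : Sym2 (Fin n) → unitInterval) (hw : ∀ e, (w e : ℝ) < 1) (A : Finset (Fin n))
    (x y : Fin n) {c : Fin n} (hc : c ∈ A) (η : ℝ) (hη : 0 ≤ η)
    (hchamp : ∀ b ∈ A, (prodBernoulli w).real (({ω : BondConfig (Fin n) | ∀ t ∈ A.erase b, ω ∉ openConn b t})) ≤ (prodBernoulli w).real (({ω : BondConfig (Fin n) | ∀ t ∈ A.erase c, ω ∉ openConn c t})) + η) :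
    (prodBernoulli w).real {ω : BondConfig (Fin n) | ω ∉ openConn c x ∧ ω ∉ openConn c y ∧
        1 ≤ (A.filter fun z => ω ∈ openConn x z ∨ ω ∈ openConn y z).card ∧
        (A.filter fun z => ω ∈ openConn x z ∨ ω ∈ openConn y z).card ≤ 1} ≤
      (prodBernoulli w).real (({ω : BondConfig (Fin n) | ∀ t ∈ A.erase c, ω ∉ openConn c t}) ∩ ({ω : BondConfig (Fin n) | ω ∉ openConn c x ∧ ω ∉ openConn c y})) + η := by
  set μ := prodBernoulli w with hμ
  have hM : 0 < μ.real (({ω : BondConfig (Fin n) | ∀ a ∈ A, ∀ a' ∈ A, a ≠ a' → ω ∉ openConn a a'})) := singleFinger_pairSep_real_pos w hw A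
  set S : Fin n → Set (BondConfig (Fin n)) := fun b =>
    ({ω : BondConfig (Fin n) | ∃ v ∈ ({x, y} : Finset (Fin n)), ω ∈ openConn b v}) ∩ (({ω : BondConfig (Fin n) | ∀ t ∈ A.erase b, ω ∉ openConn b t}) ∩ (({ω : BondConfig (Fin n) | ∀ p ∈ (A.erase b) ×ˢ ({x, y} : Finset (Fin n)), ω ∉ openConn p.1 p.2}) ∩ ({ω : BondConfig (Fin n) | ∀ p ∈ (A.erase b).offDiag, ω ∉ openConn p.1 p.2}))) with hS
  -- union bound for the left event
  have hL : μ.real {ω : BondConfig (Fin n) | ω ∉ openConn c x ∧ ω ∉ openConn c y ∧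
      1 ≤ (A.filter fun z => ω ∈ openConn x z ∨ ω ∈ openConn y z).card ∧
      (A.filter fun z => ω ∈ openConn x z ∨ ω ∈ openConn y z).card ≤ 1} ≤
      ∑ b ∈ A.erase c, μ.real ((({ω : BondConfig (Fin n) | ∃ v ∈ ({x, y} : Finset (Fin n)), ω ∈ openConn b v}) ∩ (({ω : BondConfig (Fin n) | ∀ t ∈ A.erase b, ω ∉ openConn b t}) ∩ ({ω : BondConfig (Fin n) | ∀ p ∈ (A.erase b) ×ˢ ({x, y} : Finset (Fin n)), ω ∉ openConn p.1 p.2})))) :=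
    (measureReal_mono (lhs_subset_biUnion A x y c) (measure_ne_top _ _)).trans
      (measureReal_biUnion_finset_le _ _)
  -- the disjoint pieces inside `M ∩ N`
  have hsum : ∑ b ∈ A.erase c, μ.real (S b) ≤ μ.real (({ω : BondConfig (Fin n) | ∀ a ∈ A, ∀ a' ∈ A, a ≠ a' → ω ∉ openConn a a'}) ∩ ({ω : BondConfig (Fin n) | ω ∉ openConn c x ∧ ω ∉ openConn c y})) := by
    rw [← measureReal_biUnion_finset (pairwiseDisjoint_Eb A x y c) (fun b _ => MeasurableSet.of_discrete)]
    exact measureReal_mono (Set.iUnion₂_subset fun b hb => Eb_inter_subset A x y hb hc)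
      (measure_ne_top _ _)
  -- termwise rows and champion slack
  have hterm : ∀ b ∈ A.erase c, μ.real ((({ω : BondConfig (Fin n) | ∃ v ∈ ({x, y} : Finset (Fin n)), ω ∈ openConn b v}) ∩ (({ω : BondConfig (Fin n) | ∀ t ∈ A.erase b, ω ∉ openConn b t}) ∩ ({ω : BondConfig (Fin n) | ∀ p ∈ (A.erase b) ×ˢ ({x, y} : Finset (Fin n)), ω ∉ openConn p.1 p.2})))) * μ.real (({ω : BondConfig (Fin n) | ∀ a ∈ A, ∀ a' ∈ A, a ≠ a' → ω ∉ openConn a a'})) ≤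
      (μ.real (({ω : BondConfig (Fin n) | ∀ t ∈ A.erase c, ω ∉ openConn c t})) + η) * μ.real (S b) := by
    intro b hb
    have hbA : b ∈ A := (Finset.mem_erase.1 hb).2
    exact (row_b w A x y hbA).trans (mul_le_mul_of_nonneg_right (hchamp b hbA) measureReal_nonneg)
  have h1 : (∑ b ∈ A.erase c, μ.real ((({ω : BondConfig (Fin n) | ∃ v ∈ ({x, y} : Finset (Fin n)), ω ∈ openConn b v}) ∩ (({ω : BondConfig (Fin n) | ∀ t ∈ A.erase b, ω ∉ openConn b t}) ∩ ({ω : BondConfig (Fin n) | ∀ p ∈ (A.erase b) ×ˢ ({x, y} : Finset (Fin n)), ω ∉ openConn p.1 p.2}))))) * μ.real (({ω : BondConfig (Fin n) | ∀ a ∈ A, ∀ a' ∈ A, a ≠ a' → ω ∉ openConn a a'})) ≤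
      (μ.real (({ω : BondConfig (Fin n) | ∀ t ∈ A.erase c, ω ∉ openConn c t})) + η) * μ.real (({ω : BondConfig (Fin n) | ∀ a ∈ A, ∀ a' ∈ A, a ≠ a' → ω ∉ openConn a a'}) ∩ ({ω : BondConfig (Fin n) | ω ∉ openConn c x ∧ ω ∉ openConn c y})) := by
    rw [Finset.sum_mul]
    calc ∑ b ∈ A.erase c, μ.real ((({ω : BondConfig (Fin n) | ∃ v ∈ ({x, y} : Finset (Fin n)), ω ∈ openConn b v}) ∩ (({ω : BondConfig (Fin n) | ∀ t ∈ A.erase b, ω ∉ openConn b t}) ∩ ({ω : BondConfig (Fin n) | ∀ p ∈ (A.erase b) ×ˢ ({x, y} : Finset (Fin n)), ω ∉ openConn p.1 p.2})))) * μ.real (({ω : BondConfig (Fin n) | ∀ a ∈ A, ∀ a' ∈ A, a ≠ a' → ω ∉ openConn a a'}))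
        ≤ ∑ b ∈ A.erase c, (μ.real (({ω : BondConfig (Fin n) | ∀ t ∈ A.erase c, ω ∉ openConn c t})) + η) * μ.real (S b) := Finset.sum_le_sum hterm
      _ = (μ.real (({ω : BondConfig (Fin n) | ∀ t ∈ A.erase c, ω ∉ openConn c t})) + η) * ∑ b ∈ A.erase c, μ.real (S b) := (Finset.mul_sum _ _ _).symm
      _ ≤ (μ.real (({ω : BondConfig (Fin n) | ∀ t ∈ A.erase c, ω ∉ openConn c t})) + η) * μ.real (({ω : BondConfig (Fin n) | ∀ a ∈ A, ∀ a' ∈ A, a ≠ a' → ω ∉ openConn a a'}) ∩ ({ω : BondConfig (Fin n) | ω ∉ openConn c x ∧ ω ∉ openConn c y})) :=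
          mul_le_mul_of_nonneg_left hsum (by linarith [(measureReal_nonneg : 0 ≤ μ.real (({ω : BondConfig (Fin n) | ∀ t ∈ A.erase c, ω ∉ openConn c t})))])
  have hMN : μ.real (({ω : BondConfig (Fin n) | ∀ a ∈ A, ∀ a' ∈ A, a ≠ a' → ω ∉ openConn a a'}) ∩ ({ω : BondConfig (Fin n) | ω ∉ openConn c x ∧ ω ∉ openConn c y})) ≤ μ.real (({ω : BondConfig (Fin n) | ∀ a ∈ A, ∀ a' ∈ A, a ≠ a' → ω ∉ openConn a a'})) :=
    measureReal_mono inter_subset_left (measure_ne_top _ _)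
  have h2 : (μ.real (({ω : BondConfig (Fin n) | ∀ t ∈ A.erase c, ω ∉ openConn c t})) + η) * μ.real (({ω : BondConfig (Fin n) | ∀ a ∈ A, ∀ a' ∈ A, a ≠ a' → ω ∉ openConn a a'}) ∩ ({ω : BondConfig (Fin n) | ω ∉ openConn c x ∧ ω ∉ openConn c y})) ≤
      μ.real (({ω : BondConfig (Fin n) | ∀ a ∈ A, ∀ a' ∈ A, a ≠ a' → ω ∉ openConn a a'})) * μ.real (({ω : BondConfig (Fin n) | ∀ t ∈ A.erase c, ω ∉ openConn c t}) ∩ ({ω : BondConfig (Fin n) | ω ∉ openConn c x ∧ ω ∉ openConn c y})) + η * μ.real (({ω : BondConfig (Fin n) | ∀ a ∈ A, ∀ a' ∈ A, a ≠ a' → ω ∉ openConn a a'})) := by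
    have := row_c w A x y hc
    nlinarith [this, hMN, hη, (measureReal_nonneg : 0 ≤ μ.real (({ω : BondConfig (Fin n) | ∀ a ∈ A, ∀ a' ∈ A, a ≠ a' → ω ∉ openConn a a'}) ∩ ({ω : BondConfig (Fin n) | ω ∉ openConn c x ∧ ω ∉ openConn c y})))]
  have h3 : μ.real {ω : BondConfig (Fin n) | ω ∉ openConn c x ∧ ω ∉ openConn c y ∧
      1 ≤ (A.filter fun z => ω ∈ openConn x z ∨ ω ∈ openConn y z).card ∧
      (A.filter fun z => ω ∈ openConn x z ∨ ω ∈ openConn y z).card ≤ 1} * μ.real (({ω : BondConfig (Fin n) | ∀ a ∈ A, ∀ a' ∈ A, a ≠ a' → ω ∉ openConn a a'})) ≤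
      (μ.real (({ω : BondConfig (Fin n) | ∀ t ∈ A.erase c, ω ∉ openConn c t}) ∩ ({ω : BondConfig (Fin n) | ω ∉ openConn c x ∧ ω ∉ openConn c y})) + η) * μ.real (({ω : BondConfig (Fin n) | ∀ a ∈ A, ∀ a' ∈ A, a ≠ a' → ω ∉ openConn a a'})) := by
    calc _ ≤ (∑ b ∈ A.erase c, μ.real ((({ω : BondConfig (Fin n) | ∃ v ∈ ({x, y} : Finset (Fin n)), ω ∈ openConn b v}) ∩ (({ω : BondConfig (Fin n) | ∀ t ∈ A.erase b, ω ∉ openConn b t}) ∩ ({ω : BondConfig (Fin n) | ∀ p ∈ (A.erase b) ×ˢ ({x, y} : Finset (Fin n)), ω ∉ openConn p.1 p.2}))))) * μ.real (({ω : BondConfig (Fin n) | ∀ a ∈ A, ∀ a' ∈ A, a ≠ a' → ω ∉ openConn a a'})) :=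
          mul_le_mul_of_nonneg_right hL measureReal_nonneg
      _ ≤ (μ.real (({ω : BondConfig (Fin n) | ∀ t ∈ A.erase c, ω ∉ openConn c t})) + η) * μ.real (({ω : BondConfig (Fin n) | ∀ a ∈ A, ∀ a' ∈ A, a ≠ a' → ω ∉ openConn a a'}) ∩ ({ω : BondConfig (Fin n) | ω ∉ openConn c x ∧ ω ∉ openConn c y})) := h1
      _ ≤ μ.real (({ω : BondConfig (Fin n) | ∀ a ∈ A, ∀ a' ∈ A, a ≠ a' → ω ∉ openConn a a'})) * μ.real (({ω : BondConfig (Fin n) | ∀ t ∈ A.erase c, ω ∉ openConn c t}) ∩ ({ω : BondConfig (Fin n) | ω ∉ openConn c x ∧ ω ∉ openConn c y})) + η * μ.real (({ω : BondConfig (Fin n) | ∀ a ∈ A, ∀ a' ∈ A, a ≠ a' → ω ∉ openConn a a'})) := h2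
      _ = (μ.real (({ω : BondConfig (Fin n) | ∀ t ∈ A.erase c, ω ∉ openConn c t}) ∩ ({ω : BondConfig (Fin n) | ω ∉ openConn c x ∧ ω ∉ openConn c y})) + η) * μ.real (({ω : BondConfig (Fin n) | ∀ a ∈ A, ∀ a' ∈ A, a ≠ a' → ω ∉ openConn a a'})) := by ring
  exact le_of_mul_le_mul_right h3 hM

end CSLevelOne

end Summit.CriticalPhenomena.PercolationContinuityZ3.Theorems

end
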